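import Literature.NumberTheory.EllipticCurves.DivisionFieldRamificationDividesProofs
import HarnessLib

/-!
# Division fields at multiplicative places: the ramification index divides `n`, for SQUAREFREE `n`
# ([IUTchIV] Prop. 1.8 (vii), second sentence, for every squarefree level prime to `v`)

`Proofs` file (theorems only: no definition, no named fact), topic `NumberTheory/EllipticCurves`;
sequel of `DivisionFieldRamificationProofs` (abc-iut-S2: "`e(Q ∣ v)` is a power of `p`") and
`DivisionFieldRamificationDividesProofs` ("`e(Q ∣ v) ∣ p`" at prime level).

S. Mochizuki, *Inter-universal Teichmüller theory IV*, Prop. 1.8 (vii), kurims p. 19, second sentence: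
"If `E_k` has bad multiplicative reduction over `O_k`, then the kernel of the action of `G_k` on `E_k[n]`
determines a tamely ramified extension of `k` whose ramification index over `k` divides `n`" (`n`
invertible in `O_k`; classical: Silverman *ATAEC* V.4–V.5, Ex. 5.13 (b); [NerMod] §7.4 Thm. 5).
GLOBAL number-field form, for every SQUAREFREE `n` (the prime-power case needs the common fixed vector
of the Tate shape and is not treated here): `E/K` elliptic over a number field, `v` a place of
multiplicative reduction, `n = ∏_{p ∈ S} p` a product of distinct primes with `v ∤ p` for `p ∈ S`,
`L ⊆ K̄` finite Galois over `K` with `L ⊆ K(E[n])` (`ker ρ̄_{E,n} ≤ Gal(K̄/L)`), `Q` a prime of `𝓞 L`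
over `v`:

* `WeierstrassCurve.natCard_map_inertia_galoisRepTorsion_dvd_prime` — the image of the inertia group
  `I_𝔓 ≤ Γ_K` (`𝔓 ∣ v` a prime of `\bar ℤ_K`) in `Aut(E[p])` has order dividing `p` (unipotence of
  inertia ⟹ exponent `p` ⟹ a `p`-subgroup of `Aut(E[p]) ≅ GL₂(𝔽_p)`, whose `p`-part is `p`);
* `WeierstrassCurve.ker_galoisRepTorsion_inf_le_of_isCoprime` — `ker ρ̄_a ∩ ker ρ̄_b ≤ ker ρ̄_{ab}` for
  coprime `a, b` (`E[ab] = E[a] + E[b]`, Bézout);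
* `WeierstrassCurve.natCard_map_inertia_galoisRepTorsion_dvd_prod` — the image of `I_𝔓` in `Aut(E[n])`
  has order dividing `n = ∏_{p∈S} p`;
* **`WeierstrassCurve.ramificationIdx_divisionField_dvd_prod_of_hasMultiplicativeReductionAt`** —
  `e(Q ∣ v) ∣ ∏_{p∈S} p`, and the `Squarefree n` phrasing
  **`WeierstrassCurve.ramificationIdx_divisionField_dvd_of_squarefree`** — `e(Q ∣ v) ∣ n`.

Group-theoretic bookkeeping exported on the way (`Literature.NumberTheory.EllipticCurves` namespace):
`natCard_map_eq_index_subgroupOf`, `natCard_map_dvd_of_ker_inf_le`, `index_inf_dvd_mul_index`,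
`natCard_map_dvd_mul_of_ker_inf_le`.  Classical algebraic number theory; nothing here bears on
[IUTchIII] Cor. 3.12.

## References

* [SilvermanATAEC1994] J. H. Silverman, *Advanced Topics in the Arithmetic of Elliptic Curves* (1994),
  V.4–V.5, Exercise 5.13 (b).
* [NeukirchANT1999] J. Neukirch, *Algebraic Number Theory* (1999), Ch. I §9 (9.6), (9.9).
* [Mochizuki2012] S. Mochizuki, *Inter-universal Teichmüller theory IV*, Prop. 1.8 (vii) p. 19.
-/

noncomputable section

open scoped Pointwise IntermediateField NumberField

open NumberField IsDedekindDomain IntermediateField Field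

universe u

namespace Literature.NumberTheory.EllipticCurves

/-! ### Group-theoretic bookkeeping: orders of images of a subgroup -/

section Group

variable {G M M' N : Type*} [Group G] [Group M] [Group M'] [Group N]

/-- `#f(H) = [H : H ∩ ker f]`. [cite: NeukirchANT1999, Ch. I §9 (9.9)] -/
theorem natCard_map_eq_index_subgroupOf (f : G →* M) (H : Subgroup G) :
    Nat.card (H.map f) = (f.ker.subgroupOf H).index := by
  rw [Subgroup.subgroupOf, MonoidHom.comap_ker, Subgroup.index_ker, MonoidHom.range_comp,
    Subgroup.range_subtype]

/-- If `ker f ∩ H ≤ ker g` then `#g(H) ∣ #f(H)` (`g|_H` factors through `f|_H`).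
[cite: NeukirchANT1999, Ch. I §9 (9.9)] -/
theorem natCard_map_dvd_of_ker_inf_le (f : G →* M) (g : G →* N) (H : Subgroup G)
    (h : f.ker ⊓ H ≤ g.ker) : Nat.card (H.map g) ∣ Nat.card (H.map f) := by
  rw [natCard_map_eq_index_subgroupOf, natCard_map_eq_index_subgroupOf]
  refine Subgroup.index_dvd_of_le fun x hx => ?_
  rw [Subgroup.mem_subgroupOf] at hx ⊢
  exact h ⟨hx, x.2⟩

/-- For a NORMAL subgroup `H₁`: `[G : H₁ ∩ H₂] ∣ [G : H₁]·[G : H₂]` (`G/(H₁ ∩ H₂) ↪ G/H₁ × G/H₂`).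
[cite: NeukirchANT1999, Ch. I §9 (9.9)] -/
theorem index_inf_dvd_mul_index (H₁ H₂ : Subgroup G) [H₁.Normal] :
    (H₁ ⊓ H₂).index ∣ H₁.index * H₂.index := by
  rw [← Subgroup.relIndex_mul_index (inf_le_right : H₁ ⊓ H₂ ≤ H₂), Subgroup.inf_relIndex_right]
  exact mul_dvd_mul_right (Subgroup.relIndex_dvd_index_of_normal H₁ H₂) _

/-- If `ker f₁ ∩ ker f₂ ∩ H ≤ ker g` then `#g(H) ∣ #f₁(H) · #f₂(H)`. [cite: NeukirchANT1999, Ch. I §9 (9.9)] -/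
theorem natCard_map_dvd_mul_of_ker_inf_le (f₁ : G →* M) (f₂ : G →* M') (g : G →* N)
    (H : Subgroup G) (h : f₁.ker ⊓ f₂.ker ⊓ H ≤ g.ker) :
    Nat.card (H.map g) ∣ Nat.card (H.map f₁) * Nat.card (H.map f₂) := by
  rw [natCard_map_eq_index_subgroupOf, natCard_map_eq_index_subgroupOf,
    natCard_map_eq_index_subgroupOf]
  haveI : (f₁.ker.subgroupOf H).Normal := inferInstance
  refine (Subgroup.index_dvd_of_le (K := g.ker.subgroupOf H)
    (H := f₁.ker.subgroupOf H ⊓ f₂.ker.subgroupOf H) fun x hx => ?_).trans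
    (index_inf_dvd_mul_index _ _)
  rw [Subgroup.mem_inf, Subgroup.mem_subgroupOf, Subgroup.mem_subgroupOf] at hx
  rw [Subgroup.mem_subgroupOf]
  exact h ⟨⟨hx.1, hx.2⟩, x.2⟩

end Group

/-- If `p` is prime and `p^k ∣ (p² − 1)(p² − p) = #GL₂(𝔽_p)`, then `p^k ∣ p`. [folklore] -/
private theorem pow_dvd_prime_of_pow_dvd_card_GL_two' {p k : ℕ} (hp : p.Prime)
    (h : p ^ k ∣ (p ^ 2 - 1) * (p ^ 2 - p)) : p ^ k ∣ p := by
  have hfac : (p ^ 2 - 1) * (p ^ 2 - p) = p * ((p - 1) * (p + 1) * (p - 1)) := by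
    have h1 : p ^ 2 - 1 = (p - 1) * (p + 1) := by
      rw [mul_comm, ← Nat.sq_sub_sq, one_pow]
    have h2 : p ^ 2 - p = p * (p - 1) := by
      rw [Nat.mul_sub, mul_one, sq]
    rw [h1, h2]; ring
  rw [hfac] at h
  have hcop1 : Nat.Coprime p (p - 1) := by
    refine (Nat.Prime.coprime_iff_not_dvd hp).mpr fun hd => ?_
    have hlt : p - 1 < p := Nat.sub_lt hp.pos one_pos
    have hpos : 0 < p - 1 := Nat.sub_pos_of_lt hp.one_lt
    exact absurd (Nat.le_of_dvd hpos hd) (not_le.mpr hlt)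
  have hcop2 : Nat.Coprime p (p + 1) := by
    refine (Nat.Prime.coprime_iff_not_dvd hp).mpr fun hd => ?_
    have : p ∣ 1 := (Nat.dvd_add_right (dvd_refl p)).mp hd
    exact hp.one_lt.ne' (Nat.dvd_one.mp this)
  have hcop : Nat.Coprime (p ^ k) ((p - 1) * (p + 1) * (p - 1)) :=
    Nat.Coprime.pow_left k ((hcop1.mul_right hcop2).mul_right hcop1)
  exact hcop.dvd_of_dvd_mul_right h

end Literature.NumberTheory.EllipticCurves

/-! ### Elliptic curves: images of inertia in `Aut(E[n])` and ramification in division fields -/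

namespace WeierstrassCurve

open Literature.NumberTheory.EllipticCurves Literature.NumberTheory.GaloisRepresentations
  IsDedekindDomain.HeightOneSpectrum

variable {K : Type u} [Field K] [NumberField K] (W : WeierstrassCurve K)

omit [NumberField K] in
/-- `σ ∈ ker ρ̄_{E,n}` iff `σ` fixes every `P ∈ E(K̄)` with `nP = O` (unfolding of `galoisRepTorsion`).
[folklore] -/
private theorem mem_ker_galoisRepTorsion_iff_forall (n : ℤ) (σ : absoluteGaloisGroup K) :
    σ ∈ (W.galoisRepTorsion n).ker ↔ ∀ P : W.geomPoints, n • P = 0 → σ • P = P := by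
  rw [MonoidHom.mem_ker]
  constructor
  · intro h P hP
    have h1 : σ • (⟨P, (Submodule.mem_torsionBy_iff _ _).mpr hP⟩ : geomTorsion W n) =
        ⟨P, (Submodule.mem_torsionBy_iff _ _).mpr hP⟩ := by
      rw [← galoisRepTorsion_apply, h]
      rfl
    exact congrArg Subtype.val h1
  · intro h
    refine Multiplicative.toAdd.injective (AddEquiv.ext fun P ↦ ?_)
    rw [galoisRepTorsion_apply]
    exact Subtype.ext (h P ((Submodule.mem_torsionBy_iff _ _).mp P.2))

omit [NumberField K] in
/-- **`ker ρ̄_{E,a} ∩ ker ρ̄_{E,b} ≤ ker ρ̄_{E,ab}` for coprime `a, b`**: a Galois element fixing `E[a]` and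
`E[b]` fixes `E[ab]` (`P = u·(aP) + v·(bP)` with `ua + vb = 1`, `aP ∈ E[b]`, `bP ∈ E[a]`; Silverman *AEC*
III.§7, `E[mm′] ≅ E[m] ⊕ E[m′]` for coprime `m, m′`). [cite: SilvermanAEC2009, Cor. III.6.4(b)] -/
theorem ker_galoisRepTorsion_inf_le_of_isCoprime {a b : ℤ} (hab : IsCoprime a b) :
    (W.galoisRepTorsion a).ker ⊓ (W.galoisRepTorsion b).ker ≤ (W.galoisRepTorsion (a * b)).ker := by
  intro τ hτ
  obtain ⟨ha, hb⟩ := Subgroup.mem_inf.mp hτ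
  rw [mem_ker_galoisRepTorsion_iff_forall] at ha hb ⊢
  intro P hP
  obtain ⟨u, v, huv⟩ := hab
  have hbP : a • (b • P) = 0 := by rw [← mul_smul, hP]
  have haP : b • (a • P) = 0 := by rw [← mul_smul, mul_comm, hP]
  have h1 : τ • (b • P) = b • P := ha _ hbP
  have h2 : τ • (a • P) = a • P := hb _ haP
  have hdec : P = u • (a • P) + v • (b • P) := by
    rw [← mul_smul, ← mul_smul, ← add_smul, huv, one_smul]
  rw [hdec, smul_add, smul_comm τ u, smul_comm τ v, h1, h2]

section Inertia

variable [W.IsElliptic]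

/-- **The image of inertia in `Aut(E[p])` has order dividing `p`** at a place `v ∤ p` of multiplicative
reduction (`𝔓 ∣ v` a prime of `\bar ℤ_K`, `I_𝔓 ≤ Γ_K` its inertia group): every `τ ∈ I_𝔓` acts
unipotently on `E[p]` (`smul_smul_sub_eq_of_mem_inertia_geomPoints`), so `ρ̄(τ)^p = 1` and the image is a
`p`-group; it is a subgroup of `Aut(E[p]) ≅ GL₂(𝔽_p)`, of order `p·(p−1)²·(p+1)`.
[cite: SilvermanATAEC1994, V.4–V.5 and Exercise 5.13 (b)] -/
theorem natCard_map_inertia_galoisRepTorsion_dvd_prime {p : ℕ} (hp : p.Prime)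
    {v : HeightOneSpectrum (𝓞 K)} (hv : W.HasMultiplicativeReductionAt v) (hpv : (p : 𝓞 K) ∉ v.asIdeal)
    {𝔓 : Ideal (absIntegers (𝓞 K) K)} (h𝔓 : 𝔓 ∈ v.primesAbove) :
    Nat.card ((𝔓.inertia (absoluteGaloisGroup K)).map (W.galoisRepTorsion (p : ℤ))) ∣ p := by
  haveI : Fact p.Prime := ⟨hp⟩
  set H := (𝔓.inertia (absoluteGaloisGroup K)).map (W.galoisRepTorsion (p : ℤ)) with hH
  -- finiteness of `Aut(E[p])`
  have hV : Nat.card (W.geomTorsion (p : ℤ)) = p ^ 2 := W.natCard_geomTorsion_prime_eq_sq hp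
  haveI : Finite (W.geomTorsion (p : ℤ)) :=
    Nat.finite_of_card_ne_zero (by rw [hV]; exact pow_ne_zero _ hp.ne_zero)
  haveI hfinA : Finite (AddAut (W.geomTorsion (p : ℤ))) :=
    Finite.of_injective (fun e : AddAut (W.geomTorsion (p : ℤ)) => (e : W.geomTorsion (p : ℤ) →
      W.geomTorsion (p : ℤ))) DFunLike.coe_injective
  haveI : Finite (Multiplicative (AddAut (W.geomTorsion (p : ℤ)))) := hfinA
  -- every element of the image has order dividing `p`
  have hexp : ∀ h : H, h ^ p = 1 := by
    rintro ⟨x, hx⟩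
    obtain ⟨τ, hτ, rfl⟩ := hx
    apply Subtype.ext
    show (W.galoisRepTorsion (p : ℤ) τ) ^ p = 1
    have hunip : ∀ P : geomTorsion W (p : ℤ), τ • (τ • P - P) = τ • P - P := fun P ↦ Subtype.ext (by
      have hP : p ^ 1 • (P : geomPoints W) = 0 := by
        rw [pow_one, ← natCast_zsmul]
        exact (Submodule.mem_torsionBy_iff (p : ℤ) P.1).mp P.2
      simpa only [AddSubgroupClass.coe_sub,
        Literature.NumberTheory.EllipticCurves.AddSubgroup.torsionBy.coe_smul] using
        W.smul_smul_sub_eq_of_mem_inertia_geomPoints hv hp hpv le_rfl h𝔓 hτ hP)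
    exact W.galoisRepTorsion_pow_eq_one_of_unipotent hunip
  have hPG : IsPGroup p H := fun h => ⟨1, by rw [pow_one]; exact hexp h⟩
  obtain ⟨k, hk⟩ := IsPGroup.iff_card.mp hPG
  have hdvd : Nat.card H ∣ Nat.card (Multiplicative (AddAut (W.geomTorsion (p : ℤ)))) :=
    Subgroup.card_subgroup_dvd_card H
  rw [show Nat.card (Multiplicative (AddAut (W.geomTorsion (p : ℤ)))) =
      Nat.card (AddAut (W.geomTorsion (p : ℤ))) from Nat.card_congr Multiplicative.toAdd,
    W.natCard_addAut_geomTorsion hp, hk] at hdvd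
  rw [hk]
  exact pow_dvd_prime_of_pow_dvd_card_GL_two' hp hdvd

/-- **The image of inertia in `Aut(E[n])` has order dividing `n`** for `n = ∏_{p ∈ S} p` a product of
distinct primes with `v ∤ p` (`v` multiplicative): induction on `S` by
`natCard_map_inertia_galoisRepTorsion_dvd_prime` and `ker ρ̄_p ∩ ker ρ̄_{n'} ≤ ker ρ̄_{p n'}`.
[cite: SilvermanATAEC1994, V.4–V.5 and Exercise 5.13 (b)] -/
theorem natCard_map_inertia_galoisRepTorsion_dvd_prod (S : Finset ℕ) (hS : ∀ p ∈ S, p.Prime)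
    {v : HeightOneSpectrum (𝓞 K)} (hv : W.HasMultiplicativeReductionAt v)
    (hSv : ∀ p ∈ S, (p : 𝓞 K) ∉ v.asIdeal)
    {𝔓 : Ideal (absIntegers (𝓞 K) K)} (h𝔓 : 𝔓 ∈ v.primesAbove) :
    Nat.card ((𝔓.inertia (absoluteGaloisGroup K)).map
      (W.galoisRepTorsion ((∏ p ∈ S, p : ℕ) : ℤ))) ∣ ∏ p ∈ S, p := by
  classical
  induction S using Finset.induction_on with
  | empty =>
    -- `E[1] = 0`, so the image is trivial
    rw [Finset.prod_empty, Nat.dvd_one, Nat.card_eq_one_iff_unique]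
    have htriv : ∀ ν : absoluteGaloisGroup K, W.galoisRepTorsion ((1 : ℕ) : ℤ) ν = 1 := fun ν => by
      rw [← MonoidHom.mem_ker, mem_ker_galoisRepTorsion_iff_forall]
      intro P hP
      rw [Nat.cast_one, one_smul] at hP
      rw [hP, smul_zero]
    refine ⟨⟨fun x y => Subtype.ext ?_⟩, ⟨1⟩⟩
    obtain ⟨σ, -, hσ⟩ := x.2
    obtain ⟨τ, -, hτ⟩ := y.2
    rw [← hσ, ← hτ, htriv, htriv]
  | insert q S hq ih =>
    have hqS : ∀ p ∈ S, p.Prime := fun p hp => hS p (Finset.mem_insert_of_mem hp)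
    have hSv' : ∀ p ∈ S, (p : 𝓞 K) ∉ v.asIdeal := fun p hp => hSv p (Finset.mem_insert_of_mem hp)
    have hqprime : q.Prime := hS q (Finset.mem_insert_self q S)
    rw [Finset.prod_insert hq, Nat.cast_mul]
    -- `q` is coprime to `∏ S`
    have hcop : IsCoprime (q : ℤ) ((∏ p ∈ S, p : ℕ) : ℤ) := by
      rw [Int.isCoprime_iff_gcd_eq_one, Int.gcd_natCast_natCast]
      exact Nat.Coprime.prod_right fun p hp =>
        (Nat.coprime_primes hqprime (hqS p hp)).mpr (fun h => hq (h ▸ hp))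
    refine (natCard_map_dvd_mul_of_ker_inf_le (W.galoisRepTorsion (q : ℤ))
      (W.galoisRepTorsion ((∏ p ∈ S, p : ℕ) : ℤ)) _ _ ?_).trans
      (mul_dvd_mul (W.natCard_map_inertia_galoisRepTorsion_dvd_prime hqprime hv
        (hSv q (Finset.mem_insert_self q S)) h𝔓) (ih hqS hSv'))
    exact le_trans inf_le_left (W.ker_galoisRepTorsion_inf_le_of_isCoprime hcop)

/-- **Division fields at multiplicative places: `e(Q ∣ v) ∣ n` for `n = ∏_{p∈S} p` squarefree and prime
to `v`** ([IUTchIV] Prop. 1.8 (vii), second sentence): `E/K` elliptic over a number field, `L ⊆ K̄` finite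
Galois over `K` with `L ⊆ K(E[n])` (`ker ρ̄_{E,n} ≤ Gal(K̄/L)`), `v` multiplicative with `v ∤ p` for
`p ∈ S`; then `e(Q ∣ v) ∣ ∏_{p∈S} p` for every prime `Q` of `𝓞 L` over `v`.  Indeed
`e(Q ∣ v) = #I_P(Gal(L/K))` where `P = 𝔓 ∩ 𝓞 L`, every element of `I_P(Gal(L/K))` is the restriction of
an element of `I_𝔓` (`exists_mem_inertia_restrict_eq`), the restriction of `I_𝔓` to `L` is a quotient
of its image in `Aut(E[n])` (`ker ρ̄ ≤ Gal(K̄/L)`), and that image has order dividing `n`.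
[cite: SilvermanATAEC1994, V.4–V.5 and Exercise 5.13 (b)] [cite: Mochizuki2012, IUTchIV Prop 1.8 (vii) p.19] -/
theorem ramificationIdx_divisionField_dvd_prod_of_hasMultiplicativeReductionAt (S : Finset ℕ)
    (hS : ∀ p ∈ S, p.Prime) (L : IntermediateField K (AlgebraicClosure K)) [FiniteDimensional K L]
    [IsGalois K L] (hL : (W.galoisRepTorsion ((∏ p ∈ S, p : ℕ) : ℤ)).ker ≤ L.fixingSubgroup)
    {v : HeightOneSpectrum (𝓞 K)} (hv : W.HasMultiplicativeReductionAt v)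
    (hSv : ∀ p ∈ S, (p : 𝓞 K) ∉ v.asIdeal) (Q : Ideal (𝓞 L)) [Q.IsPrime] [Q.LiesOver v.asIdeal] :
    Q.ramificationIdx (𝓞 K) ∣ ∏ p ∈ S, p := by
  obtain ⟨𝔓, h𝔓⟩ := HeightOneSpectrum.primesAbove_nonempty v
  rw [@ramificationIdx_eq_card_inertia_comap K _ _ L _ _ v 𝔓 h𝔓.1 h𝔓.2 Q _ _]
  -- (1) `I_P(Gal(L/K)) ≤` the restriction of `I_𝔓` to `L`
  set r : (AlgebraicClosure K ≃ₐ[K] AlgebraicClosure K) →* (L ≃ₐ[K] L) :=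
    AlgEquiv.restrictNormalHom L with hr
  have h1 : (𝔓.comap (ringOfIntegersToIntegralClosure (k := K) (Ω := AlgebraicClosure K) L)).inertia
      (L ≃ₐ[K] L) ≤ (𝔓.inertia (absoluteGaloisGroup K)).map r := by
    intro g hg
    obtain ⟨σ, hσ, hσg⟩ := @exists_mem_inertia_restrict_eq K _ _ L _ _ 𝔓 h𝔓.1 g hg
    refine ⟨σ, hσ, AlgEquiv.ext fun x => Subtype.ext ?_⟩
    rw [hr, AlgEquiv.restrictNormalHom_apply]
    exact hσg x
  -- (2) the restriction of `I_𝔓` to `L` is a quotient of its image in `Aut(E[n])`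
  have h2 : Nat.card ((𝔓.inertia (absoluteGaloisGroup K)).map r) ∣
      Nat.card ((𝔓.inertia (absoluteGaloisGroup K)).map
        (W.galoisRepTorsion ((∏ p ∈ S, p : ℕ) : ℤ))) := by
    refine natCard_map_dvd_of_ker_inf_le _ _ _ (le_trans inf_le_left (le_trans hL ?_))
    rw [hr, IntermediateField.restrictNormalHom_ker]
  exact (Subgroup.card_dvd_of_le h1).trans
    (h2.trans (W.natCard_map_inertia_galoisRepTorsion_dvd_prod S hS hv hSv h𝔓))

/-- **[IUTchIV] Prop. 1.8 (vii), second sentence, for every SQUAREFREE level `n` prime to `v`**: with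
`E/K`, `L ⊆ K(E[n])` finite Galois over `K`, `v` a place of multiplicative reduction and
`(n : 𝓞 K) ∉ v` ("`n` invertible in `O_k`"), the ramification index of every prime `Q` of `𝓞 L` over `v`
DIVIDES `n`. [cite: Mochizuki2012, IUTchIV Prop 1.8 (vii) p.19] [cite: SilvermanATAEC1994, V.4–V.5 and Exercise 5.13 (b)] -/
theorem ramificationIdx_divisionField_dvd_of_squarefree {n : ℕ} (hn : Squarefree n)
    (L : IntermediateField K (AlgebraicClosure K)) [FiniteDimensional K L] [IsGalois K L]
    (hL : (W.galoisRepTorsion (n : ℤ)).ker ≤ L.fixingSubgroup)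
    {v : HeightOneSpectrum (𝓞 K)} (hv : W.HasMultiplicativeReductionAt v) (hnv : (n : 𝓞 K) ∉ v.asIdeal)
    (Q : Ideal (𝓞 L)) [Q.IsPrime] [Q.LiesOver v.asIdeal] :
    Q.ramificationIdx (𝓞 K) ∣ n := by
  have hprod : (∏ p ∈ n.primeFactors, p : ℕ) = n := Nat.prod_primeFactors_of_squarefree hn
  have hSv : ∀ p ∈ n.primeFactors, (p : 𝓞 K) ∉ v.asIdeal := by
    intro p hp hpv
    obtain ⟨m, hm⟩ := Nat.dvd_of_mem_primeFactors hp
    apply hnv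
    rw [hm, Nat.cast_mul]
    exact v.asIdeal.mul_mem_right _ hpv
  have h := W.ramificationIdx_divisionField_dvd_prod_of_hasMultiplicativeReductionAt n.primeFactors
    (fun p hp => Nat.prime_of_mem_primeFactors hp) L (by rwa [hprod]) hv hSv Q
  rwa [hprod] at h

end Inertia

end WeierstrassCurve

end
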